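import Literature.Barriers.SmoothPoincare4.LowGenusTrisectionsStandardOfClassification
import Literature.Topology.FourManifolds.LoopSurgeryHomotopySphereProofs
import Literature.Topology.FourManifolds.TrisectionFunctorGKCentralSurface
import HarnessLib

/-!
# Aranda–Zupan's genus-three fact: the printed endgame through the loop-surgery fact

Barrier catalogue `Literature/Barriers/SmoothPoincare4/` (D-0021), companion of
`WeaklyReducibleGenusThreeStandard(Proofs).lean` and
`LowGenusTrisectionsStandardOfClassification.lean` (the named fact
`az2025_weaklyReducible_genusThree_homotopySphere_gk`: a smooth homotopy 4-sphere with a weakly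
reducible genus-three Gay–Kirby trisection is `S⁴`; Aranda–Zupan, arXiv:2503.04607, Thm. 1.3
restricted to homotopy spheres).  **Everything here is proved; no definition, no named fact.**

State of the fact before this file (all glue PROVED in the two companions): at every universe it
follows from (1) the Meier–Schirmer–Zupan classification `msz_trisection_classification_gk` (or
its homotopy-sphere corollary `msz_homotopySphere_gk`), (2) the separating splitting fact
`Trisection.isConnectedSum_of_reducing_separating`, (3) the `π₁`-shadow of the non-separating
case (a theorem in the making, inline hypothesis) and (4) Aranda–Zupan's IRREDUCIBLE CORE, inline:
a closed connected oriented `X : Type` with a balanced `(3; 1)`-trisection carrying a weak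
reduction and NO reducing curve, homotopy equivalent to `S⁴`, is diffeomorphic to `S⁴`
(`az2025_weaklyReducible_genusThree_homotopySphere_gk_of_classification_of_sep_of_pi1_of_irreducible`).

The printed proof of the core (Aranda–Zupan §6, p. 24) ends as follows: an irreducible weakly
reducible genus-three trisection `T` contains a five-chain (Thm. 1.3, first part, via Prop. 3.9
and §4); five-chain surgery turns `T` into a `(2; k₁, k₂, k₃ + 1)`-trisection `T′` of a
4-manifold `X′` (Lemma 5.4; `(2; 1, 1, 2)` in the balanced case), and "`X` is obtained by surgery
on a loop in `X′`" (Prop. 5.5); then "the main theorem from [MZ17b] implies that `T′` is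
standard … `X′` is diffeomorphic to `S¹ × S³`, and by Proposition 5.5, `X` is obtained by
surgery on a loop in `S¹ × S³`, implying that `X` is diffeomorphic to `S_p` or `S′_p`", and
`S_{±1} ≅ S′_{±1} ≅ S⁴` (§2 p. 7; Pao 1977) is the homotopy-sphere case.  The tree now carries
this ENDGAME as the named fact
`Literature.Topology.FourManifolds.msz_loopSurgery_homotopySphere_gk`
(`LoopSurgeryHomotopySphere.lean`; Meier–Schirmer–Zupan Thm. 1.2 + Pao: a loop surgery
`IsCircleSurgery X′ M ℓ` on a closed connected orientable `X′` with a `(g; k)`-trisection in the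
MSZ range `∃ i, g ≤ kᵢ + 1` which is a homotopy 4-sphere is `S⁴`), together with the PROVED
`isOrientable_of_isCircleSurgery_four_holds` (orientability of `X′` from that of `M`).  This
file feeds it in:

* `IsGKTrisection.connectedSpace` — a GK-trisected 4-manifold is connected (the three sectors
  are connected and meet along the non-empty central surface);
* `nonempty_diffeomorph_sphere_of_isCircleSurgery_of_mszRange` — the loop-surgery fact with
  its compactness, connectedness and orientability hypotheses on `X′` DISCHARGED
  (`IsGKTrisection.compactSpace`, `IsGKTrisection.connectedSpace`,
  `isOrientable_of_homotopyEquiv_sphere_four_holds`, `isOrientable_of_isCircleSurgery_four_holds`);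
* `az2025_irreducibleCore_zero_of_loopSurgery_of_fiveChainSurgery` — **the irreducible core at
  universe `0` follows from `msz_loopSurgery_homotopySphere_gk` and the FIVE-CHAIN SURGERY
  STEP**, the latter as an inline hypothesis in tree vocabulary: *a closed connected oriented
  `X : Type` with a balanced `(3; 1)`-trisection carrying a weak reduction and no reducing curve
  is a circle surgery `IsCircleSurgery (𝓡 4) (𝓡 4) X′ X ℓ` on a smoothly embedded loop `ℓ` in
  some `X′ : Type` admitting a genus-`2` GK-trisection in the MSZ range* (Aranda–Zupan Thm. 1.3
  first part + Lemma 5.4 + Prop. 5.5; the printed `(2; 1, 1, 2)` satisfies the range condition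
  with its third index; this step is the diagrammatic heart of the paper — Prop. 3.9, §4, §5 —
  and has no tree counterpart; it is NOT vendored here, D-0026);
* `az2025_weaklyReducible_genusThree_homotopySphere_gk_of_classification_of_sep_of_pi1_of_loopSurgery_of_fiveChainSurgery`
  and `…_of_msz_zero_of_sep_of_pi1_of_loopSurgery_of_fiveChainSurgery` — **where the fact
  stands**: at every universe it follows from the classification (any universe) or
  `msz_homotopySphere_gk.{0}`, the separating splitting fact at universe `0`, the `π₁`-shadow at
  universe `0`, `msz_loopSurgery_homotopySphere_gk`, and the five-chain surgery step at
  universe `0`.  Every input but the last is an existing named fact of the tree (or a theorem in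
  the making); the last is exactly the part of Aranda–Zupan's paper that is specific to it.

## References

* R. Aranda, A. Zupan, *Manifolds with weakly reducible genus-three trisections are standard*,
  arXiv:2503.04607 (2025), Thm. 1.3 (p. 2), Lemma 5.4, Prop. 5.5 (pp. 19–20), §6 (pp. 20–24),
  §2 p. 7 (`S₁ ≅ S′₁ ≅ S⁴`). [ArandaZupan2025]
* J. Meier, T. Schirmer, A. Zupan, *Classification of trisections and the Generalized Property R
  Conjecture*, Proc. AMS 144 (2016) 4983–4997, Thm. 1.2. [MeierSchirmerZupan2016]
* J. Meier, A. Zupan, *Genus-two trisections are standard*, Geom. Topol. 21 (2017). [MeierZupan2017]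
* P. S. Pao, *The topological structure of 4-manifolds with effective torus actions. I*,
  Trans. AMS 227 (1977). [Pao1977]
* D. T. Gay, R. Kirby, *Trisecting 4-manifolds*, Geom. Topol. 20 (2016), Def. 1, Remark 2.
  [GayKirby2016]
-/

noncomputable section

open scoped Manifold ContDiff Topology
open Set ContinuousMap

namespace Literature.Barriers.SmoothPoincare4

universe u v

open Literature.Topology.FourManifolds Literature.Topology.FourManifolds.Trisection

/-! ### A GK-trisected manifold is connected -/

/-- **A Gay–Kirby trisected 4-manifold is connected**: each sector `X_i` is the continuous image
of the connected handlebody `W` of clause (ii), and the three sectors contain the non-empty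
central surface `F = X₀ ∩ X₁ ∩ X₂` (`IsGKTrisection.nonempty_iInter`), so their union `X` is
connected (Gay–Kirby, Def. 1: "`X = X₁ ∪ X₂ ∪ X₃`" with each `X_i ≅ ♮ᵏ(S¹ × B³)`).  A dot-notation
extension of `Literature.Topology.FourManifolds.IsGKTrisection` (`Trisections.lean`), declared
with its absolute name (CONVENTIONS §2). [cite: GayKirby2016, Def. 1 and Remark 2] -/
theorem _root_.Literature.Topology.FourManifolds.IsGKTrisection.connectedSpace {X : Type u}
    [TopologicalSpace X] [T2Space X] [ChartedSpace (EuclideanSpace ℝ (Fin 4)) X] {g : ℕ}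
    {k : Fin 3 → ℕ} {S : Fin 3 → Set X} (h : IsGKTrisection X g k S) : ConnectedSpace X := by
  rw [connectedSpace_iff_univ, ← h.iUnion_eq]
  refine ⟨(h.nonempty_iInter.mono (iInter_subset S 0)).mono (subset_iUnion S 0),
    isPreconnected_iUnion h.nonempty_iInter fun i => ?_⟩
  obtain ⟨W, _, _, e, -, -, hW, -, he, hrange, -⟩ := h.2.1 i
  rw [← hrange]
  exact (isConnected_range he.continuous).isPreconnected

/-! ### The loop-surgery fact with its side conditions discharged -/

/-- **`msz_loopSurgery_homotopySphere_gk` with compactness, connectedness and orientability of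
the loop partner derived.**  GIVEN the loop-surgery fact, let `X′` be a smooth 4-manifold with a
`(g; k)`-GK-trisection in the MSZ range `∃ i, g ≤ kᵢ + 1`, `ℓ ⊂ X′` a smoothly embedded loop and
`X` a smooth homotopy 4-sphere with `IsCircleSurgery (𝓡 4) (𝓡 4) X′ X ℓ`; then `X ≅ S⁴`.  Here
`X′` is compact and connected because it is trisected (`IsGKTrisection.compactSpace`,
`IsGKTrisection.connectedSpace`), `X` is orientable as a homotopy 4-sphere (Lee Thm. 15.43,
`isOrientable_of_homotopyEquiv_sphere_four_holds`) and `X′` inherits orientability from its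
surgery `X` (Hirsch §4.4, `isOrientable_of_isCircleSurgery_four_holds`).
[cite: MeierSchirmerZupan2016, Thm. 1.2] [cite: ArandaZupan2025, §2 p. 7] -/
theorem nonempty_diffeomorph_sphere_of_isCircleSurgery_of_mszRange
    (hL : msz_loopSurgery_homotopySphere_gk)
    {X' : Type} [TopologicalSpace X'] [T2Space X'] [SecondCountableTopology X']
    [ChartedSpace (EuclideanSpace ℝ (Fin 4)) X'] [IsManifold (𝓡 4) ∞ X']
    {g : ℕ} {k : Fin 3 → ℕ} {S' : Fin 3 → Set X'} (hT' : IsGKTrisection X' g k S')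
    (hk : ∃ i, g ≤ k i + 1)
    {ℓ : Metric.sphere (0 : EuclideanSpace ℝ (Fin 2)) 1 → X'}
    (hℓ : Manifold.IsSmoothEmbedding (𝓡 1) (𝓡 4) ∞ ℓ)
    {X : Type} [TopologicalSpace X] [T2Space X] [SecondCountableTopology X]
    [ChartedSpace (EuclideanSpace ℝ (Fin 4)) X] [IsManifold (𝓡 4) ∞ X]
    (hs : IsCircleSurgery (𝓡 4) (𝓡 4) X' X ℓ)
    (e : X ≃ₕ (Metric.sphere (0 : EuclideanSpace ℝ (Fin 5)) 1)) :
    Nonempty (X ≃ₘ⟮𝓡 4, 𝓡 4⟯ (Metric.sphere (0 : EuclideanSpace ℝ (Fin 5)) 1)) := by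
  haveI : CompactSpace X' := hT'.compactSpace
  haveI : ConnectedSpace X' := hT'.connectedSpace
  have hX : IsOrientable (𝓡 4) X := isOrientable_of_homotopyEquiv_sphere_four_holds X e
  have hX' : IsOrientable (𝓡 4) X' := isOrientable_of_isCircleSurgery_four_holds X' ℓ X hs hX
  exact hL X' hX' g k S' hT' hk ℓ hℓ X e hs

/-! ### The irreducible core from the loop-surgery fact and the five-chain surgery step -/

/-- **Aranda–Zupan's irreducible core at universe `0` from the loop-surgery fact and the
five-chain surgery step** (PROVED glue).  GIVEN `msz_loopSurgery_homotopySphere_gk` and, as the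
inline hypothesis `h5`, the FIVE-CHAIN SURGERY STEP of the printed proof in tree vocabulary — a
closed connected oriented `X : Type` with a balanced `(3; 1)`-trisection `S` carrying a weak
reduction (`c` bounding in `H_0`, `c′` in `H_1` and `H_2`, fixed labels) and no reducing curve is
a circle surgery `IsCircleSurgery (𝓡 4) (𝓡 4) X′ X ℓ` on a smoothly embedded loop `ℓ` of some
smooth `X′ : Type` with a genus-`2` GK-trisection in the MSZ range (Aranda–Zupan: Thm. 1.3 first
part "either `T` is reducible or `T` contains a ﬁve-chain", Lemma 5.4 "`(Σ_{α₁}; α′, β′, γ′)` is a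
`(g − 1; k₁, k₂, k₃ + 1)`-trisection diagram", Prop. 5.5 "`X` is obtained by surgery on a loop in
`X′`") — every such `X` homotopy equivalent to `S⁴` is diffeomorphic to `S⁴`
(`nonempty_diffeomorph_sphere_of_isCircleSurgery_of_mszRange`).  This is the shape of the
hypothesis `hirr₀` of
`az2025_weaklyReducible_genusThree_homotopySphere_gk_of_facts_zero_of_pi1_zero_of_irreducible_zero`.
[cite: ArandaZupan2025, Thm. 1.3, Lemma 5.4, Prop. 5.5, §6 p. 24] [cite: MeierSchirmerZupan2016, Thm. 1.2] -/
theorem az2025_irreducibleCore_zero_of_loopSurgery_of_fiveChainSurgery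
    (hL : msz_loopSurgery_homotopySphere_gk)
    (h5 : ∀ (X : Type) [TopologicalSpace X] [T2Space X] [SecondCountableTopology X]
      [ChartedSpace (EuclideanSpace ℝ (Fin 4)) X] [IsManifold (𝓡 4) ∞ X] [CompactSpace X]
      [ConnectedSpace X] (_ : SmoothOrientation (𝓡 4) X) (S : Fin 3 → Set X),
      IsBalancedGKTrisection X 3 1 S →
      (∃ c c' : Set X, IsCurve S c ∧ IsCurve S c' ∧ Disjoint c c' ∧
        IsNonSeparating S c ∧ IsNonSeparating S c' ∧
        BoundsDisc S (spineHandlebody S 0) c ∧ BoundsDisc S (spineHandlebody S 1) c' ∧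
        BoundsDisc S (spineHandlebody S 2) c') →
      ¬ IsReducible S →
      ∃ (X' : Type) (_ : TopologicalSpace X') (_ : T2Space X') (_ : SecondCountableTopology X')
        (_ : ChartedSpace (EuclideanSpace ℝ (Fin 4)) X') (_ : IsManifold (𝓡 4) ∞ X')
        (k' : Fin 3 → ℕ) (S' : Fin 3 → Set X')
        (ℓ : Metric.sphere (0 : EuclideanSpace ℝ (Fin 2)) 1 → X'),
        IsGKTrisection X' 2 k' S' ∧ (∃ i, 2 ≤ k' i + 1) ∧
          Manifold.IsSmoothEmbedding (𝓡 1) (𝓡 4) ∞ ℓ ∧ IsCircleSurgery (𝓡 4) (𝓡 4) X' X ℓ)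
    (X : Type) [TopologicalSpace X] [T2Space X] [SecondCountableTopology X]
    [ChartedSpace (EuclideanSpace ℝ (Fin 4)) X] [IsManifold (𝓡 4) ∞ X] [CompactSpace X]
    [ConnectedSpace X] (o : SmoothOrientation (𝓡 4) X) (S : Fin 3 → Set X)
    (hT : IsBalancedGKTrisection X 3 1 S)
    (hwr : ∃ c c' : Set X, IsCurve S c ∧ IsCurve S c' ∧ Disjoint c c' ∧
      IsNonSeparating S c ∧ IsNonSeparating S c' ∧
      BoundsDisc S (spineHandlebody S 0) c ∧ BoundsDisc S (spineHandlebody S 1) c' ∧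
      BoundsDisc S (spineHandlebody S 2) c')
    (hirr : ¬ IsReducible S) (e : X ≃ₕ (Metric.sphere (0 : EuclideanSpace ℝ (Fin (4 + 1))) 1)) :
    Nonempty (X ≃ₘ⟮𝓡 4, 𝓡 4⟯ (Metric.sphere (0 : EuclideanSpace ℝ (Fin (4 + 1))) 1)) := by
  obtain ⟨X', _, _, _, _, _, k', S', ℓ, hT', hk', hℓ, hs⟩ := h5 X o S hT hwr hirr
  exact nonempty_diffeomorph_sphere_of_isCircleSurgery_of_mszRange hL hT' hk' hℓ hs e

/-! ### Where the fact stands -/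

/-- **Aranda–Zupan's homotopy-sphere fact, at every universe, from the Meier–Schirmer–Zupan
classification (any universe), the separating splitting fact, the `π₁`-shadow of the
non-separating case, the loop-surgery fact and the five-chain surgery step (the last four at
universe `0`)** — PROVED glue:
`az2025_weaklyReducible_genusThree_homotopySphere_gk_of_classification_of_sep_of_pi1_of_irreducible`
fed with `az2025_irreducibleCore_zero_of_loopSurgery_of_fiveChainSurgery`.  Reducible branch:
Aranda–Zupan §6 p. 20 first paragraph and §2 p. 6 (connected sum of a genus-one and a genus-two
trisection, Meier–Zupan); irreducible branch: Prop. 3.9, §4, Thm. 1.3 first part, Lemma 5.4,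
Prop. 5.5 (the hypothesis `h5`) and the [MZ17b]/Pao endgame (the loop-surgery fact).
[cite: ArandaZupan2025, Thm. 1.3 (p. 2), §6 (pp. 20–24), Lemma 5.4, Prop. 5.5] [cite: MeierSchirmerZupan2016, Thm. 1.2] -/
theorem az2025_weaklyReducible_genusThree_homotopySphere_gk_of_classification_of_sep_of_pi1_of_loopSurgery_of_fiveChainSurgery
    (hC : msz_trisection_classification_gk.{v})
    (hsep₀ : isConnectedSum_of_reducing_separating.{0})
    (hπ₀ : ∀ (X : Type) [TopologicalSpace X] [T2Space X] [SecondCountableTopology X]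
      [ChartedSpace (EuclideanSpace ℝ (Fin 4)) X] [IsManifold (𝓡 4) ∞ X] [CompactSpace X]
      [ConnectedSpace X] (_ : SmoothOrientation (𝓡 4) X) (g : ℕ) (k : Fin 3 → ℕ)
      (S : Fin 3 → Set X) (δ : Set X), IsGKTrisection X g k S → IsCurve S δ →
      (¬ ∃ e : Metric.closedBall (0 : EuclideanSpace ℝ (Fin 2)) 1 → X,
        Manifold.IsSmoothEmbedding (𝓡∂ 2) (𝓡 4) ∞ e ∧ range e ⊆ centralSurfaceSet S ∧
          e '' (𝓡∂ 2).boundary (Metric.closedBall (0 : EuclideanSpace ℝ (Fin 2)) 1) = δ) →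
      (∀ q : Fin 3, BoundsDisc S (spineHandlebody S q) δ) → IsNonSeparating S δ →
      ¬ SimplyConnectedSpace X)
    (hL : msz_loopSurgery_homotopySphere_gk)
    (h5 : ∀ (X : Type) [TopologicalSpace X] [T2Space X] [SecondCountableTopology X]
      [ChartedSpace (EuclideanSpace ℝ (Fin 4)) X] [IsManifold (𝓡 4) ∞ X] [CompactSpace X]
      [ConnectedSpace X] (_ : SmoothOrientation (𝓡 4) X) (S : Fin 3 → Set X),
      IsBalancedGKTrisection X 3 1 S →
      (∃ c c' : Set X, IsCurve S c ∧ IsCurve S c' ∧ Disjoint c c' ∧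
        IsNonSeparating S c ∧ IsNonSeparating S c' ∧
        BoundsDisc S (spineHandlebody S 0) c ∧ BoundsDisc S (spineHandlebody S 1) c' ∧
        BoundsDisc S (spineHandlebody S 2) c') →
      ¬ IsReducible S →
      ∃ (X' : Type) (_ : TopologicalSpace X') (_ : T2Space X') (_ : SecondCountableTopology X')
        (_ : ChartedSpace (EuclideanSpace ℝ (Fin 4)) X') (_ : IsManifold (𝓡 4) ∞ X')
        (k' : Fin 3 → ℕ) (S' : Fin 3 → Set X')
        (ℓ : Metric.sphere (0 : EuclideanSpace ℝ (Fin 2)) 1 → X'),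
        IsGKTrisection X' 2 k' S' ∧ (∃ i, 2 ≤ k' i + 1) ∧
          Manifold.IsSmoothEmbedding (𝓡 1) (𝓡 4) ∞ ℓ ∧ IsCircleSurgery (𝓡 4) (𝓡 4) X' X ℓ) :
    az2025_weaklyReducible_genusThree_homotopySphere_gk.{u} :=
  az2025_weaklyReducible_genusThree_homotopySphere_gk_of_classification_of_sep_of_pi1_of_irreducible
    hC hsep₀ hπ₀ (az2025_irreducibleCore_zero_of_loopSurgery_of_fiveChainSurgery hL h5)

/-- **The same assembly over `msz_homotopySphere_gk.{0}` instead of the classification**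
(PROVED glue): `az2025_weaklyReducible_genusThree_homotopySphere_gk_of_facts_zero_of_pi1_zero_of_irreducible_zero`
fed with `az2025_irreducibleCore_zero_of_loopSurgery_of_fiveChainSurgery`.
[cite: ArandaZupan2025, Thm. 1.3 (p. 2), §6 (pp. 20–24), Lemma 5.4, Prop. 5.5] [cite: MeierSchirmerZupan2016, Thm. 1.2] -/
theorem az2025_weaklyReducible_genusThree_homotopySphere_gk_of_msz_zero_of_sep_of_pi1_of_loopSurgery_of_fiveChainSurgery
    (hMSZ₀ : msz_homotopySphere_gk.{0})
    (hsep₀ : isConnectedSum_of_reducing_separating.{0})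
    (hπ₀ : ∀ (X : Type) [TopologicalSpace X] [T2Space X] [SecondCountableTopology X]
      [ChartedSpace (EuclideanSpace ℝ (Fin 4)) X] [IsManifold (𝓡 4) ∞ X] [CompactSpace X]
      [ConnectedSpace X] (_ : SmoothOrientation (𝓡 4) X) (g : ℕ) (k : Fin 3 → ℕ)
      (S : Fin 3 → Set X) (δ : Set X), IsGKTrisection X g k S → IsCurve S δ →
      (¬ ∃ e : Metric.closedBall (0 : EuclideanSpace ℝ (Fin 2)) 1 → X,
        Manifold.IsSmoothEmbedding (𝓡∂ 2) (𝓡 4) ∞ e ∧ range e ⊆ centralSurfaceSet S ∧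
          e '' (𝓡∂ 2).boundary (Metric.closedBall (0 : EuclideanSpace ℝ (Fin 2)) 1) = δ) →
      (∀ q : Fin 3, BoundsDisc S (spineHandlebody S q) δ) → IsNonSeparating S δ →
      ¬ SimplyConnectedSpace X)
    (hL : msz_loopSurgery_homotopySphere_gk)
    (h5 : ∀ (X : Type) [TopologicalSpace X] [T2Space X] [SecondCountableTopology X]
      [ChartedSpace (EuclideanSpace ℝ (Fin 4)) X] [IsManifold (𝓡 4) ∞ X] [CompactSpace X]
      [ConnectedSpace X] (_ : SmoothOrientation (𝓡 4) X) (S : Fin 3 → Set X),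
      IsBalancedGKTrisection X 3 1 S →
      (∃ c c' : Set X, IsCurve S c ∧ IsCurve S c' ∧ Disjoint c c' ∧
        IsNonSeparating S c ∧ IsNonSeparating S c' ∧
        BoundsDisc S (spineHandlebody S 0) c ∧ BoundsDisc S (spineHandlebody S 1) c' ∧
        BoundsDisc S (spineHandlebody S 2) c') →
      ¬ IsReducible S →
      ∃ (X' : Type) (_ : TopologicalSpace X') (_ : T2Space X') (_ : SecondCountableTopology X')
        (_ : ChartedSpace (EuclideanSpace ℝ (Fin 4)) X') (_ : IsManifold (𝓡 4) ∞ X')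
        (k' : Fin 3 → ℕ) (S' : Fin 3 → Set X')
        (ℓ : Metric.sphere (0 : EuclideanSpace ℝ (Fin 2)) 1 → X'),
        IsGKTrisection X' 2 k' S' ∧ (∃ i, 2 ≤ k' i + 1) ∧
          Manifold.IsSmoothEmbedding (𝓡 1) (𝓡 4) ∞ ℓ ∧ IsCircleSurgery (𝓡 4) (𝓡 4) X' X ℓ) :
    az2025_weaklyReducible_genusThree_homotopySphere_gk.{u} :=
  az2025_weaklyReducible_genusThree_homotopySphere_gk_of_facts_zero_of_pi1_zero_of_irreducible_zero
    hMSZ₀ hsep₀ hπ₀ (az2025_irreducibleCore_zero_of_loopSurgery_of_fiveChainSurgery hL h5)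

end Literature.Barriers.SmoothPoincare4

end
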